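import Literature.NumberTheory.LFunctions.LogarithmicSummabilityTauberian
import Literature.Analysis.Asymptotics.LogarithmicSummabilityTauberianProofs
import HarnessLib

/-!
# Móricz 2013, Corollary 3 — the `LFunctions` phrasing, proved

Discharge of the named fact
`Literature.NumberTheory.LFunctions.Moricz2013_cor3_logSummable_slowlyDecreasing`
(`Literature/NumberTheory/LFunctions/LogarithmicSummabilityTauberian.lean`), which states
Móricz's Corollary 3 with the predicates `IsSlowlyDecreasingLog` and `IsLogSummable` (the latter
normalised by Mathlib's `harmonic n`).  It is the theorem
`Literature.Analysis.Asymptotics.Moricz2013_corollary3_holds`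
(`Literature/Analysis/Asymptotics/LogarithmicSummabilityTauberianProofs.lean`, normalised by
`ℓ_n = Σ_{k ≤ n} 1/k`) after the identification `ℓ_n = harmonic n` (`harmonic_eq_sum_Icc`).

## References
* [Moricz2013] F. Móricz, Studia Math. 219 (2013) 109–121, arXiv:1206.6188, §5 Cor. 3.
-/

namespace Literature.NumberTheory.LFunctions

open _root_.Filter _root_.Finset
open scoped _root_.Topology

/-- `ℓ_n = Σ_{k=1}^n 1/k` is Mathlib's `harmonic n`. [folklore] -/
private theorem Moricz2013L.sum_one_div_eq_harmonic (n : ℕ) :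
    ∑ k ∈ Icc 1 n, (1 : ℝ) / k = (harmonic n : ℝ) := by
  rw [harmonic_eq_sum_Icc]
  push_cast
  exact Finset.sum_congr rfl fun k _ => one_div _

/-- **Móricz 2013, Corollary 3 — proved** (discharge of
`Moricz2013_cor3_logSummable_slowlyDecreasing`): a real sequence slowly decreasing with respect
to `(L, 1)` and `(L, 1)`-summable to `A` converges to `A`; from
`Literature.Analysis.Asymptotics.Moricz2013_corollary3_holds` with `ℓ_n = harmonic n`.
[cite: Moricz2013, Cor. 3] -/
theorem Moricz2013_cor3_logSummable_slowlyDecreasing_holds :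
    Moricz2013_cor3_logSummable_slowlyDecreasing := by
  intro s A hsd hL
  refine Literature.Analysis.Asymptotics.Moricz2013_corollary3_holds s A hsd ?_
  have e : (fun n : ℕ => (∑ k ∈ Icc 1 n, s k / k) / ∑ k ∈ Icc 1 n, (1 : ℝ) / k)
      = fun n : ℕ => (∑ k ∈ Icc 1 n, s k / (k : ℝ)) / (harmonic n : ℝ) :=
    funext fun n => by rw [Moricz2013L.sum_one_div_eq_harmonic]
  rw [e]
  exact hL

end Literature.NumberTheory.LFunctions
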